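import Mathlib.Analysis.SpecialFunctions.Pow.Continuity
import Summits.FinalStateConjecture.FinalStateConjecture.Theorems.EIHFluxBalanceInertialRecessionStaircaseBound

/-!
# Route EIHFluxBalance — crux `InertialRecession` (E′), line `SketchCleanExcision`:
# the staircase, part 8 — THE INTEGRATED CLUSTER BALANCE (registered stub `stub_integratedClusterBalance`)

Helper file for the crux `stmt-FinalStateConjecture-17403`
(`Summit.FinalStateConjecture.FinalStateConjecture.Theses.EIHFluxBalance.InertialRecession`), registered stub
`stub_integratedClusterBalance` of skeleton r12 (`Cruxes/InertialRecession/Lines/SketchCleanExcision.lean`), the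
line's defining stub (card `Ideas/clean-excision-has-a-rate.md`, First lemma).

**Statement.** For the abstract expanding system of charges of the endgame (centres `ξᵢ` in the cone `κ²t`,
pairwise separating, slaved to continuous velocities `‖vᵢ‖ ≤ k < 1`; charges `P` obeying (WL) the window law
along `2`-Lipschitz admissible window paths, (ID) identification `P = Σ_members Mⱼγⱼ(1,vⱼ) ± ζ(t)`, `ζ → 0`, and
(EXC) equal-time clean excision with a rate in SCALE, each above every threshold `ρ → ∞`): there are
`C₀, T₀, ζ₀ → 0` such that for every member set `S` isolated from its outsiders by a continuous positive
set-distance `r` on `[t₁, t₂]`, `T₀ ≤ t₁`, the kinematic energy–momentum of `S` changes by at most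
`ζ₀(t₁) + C₀ ∫_{t₁}^{t₂} (min (r s) s)^{-3/2} ds` — NO slowness, NO tightness, NO bound on the number of
re-partitions.

**Proof** (parts 1–7 of this series): choose the threshold `ρ := (λ²/8)·gsc` (`gsc` = min of `c₀s`,
`c₀ = (κ−κ²)/2`, and all mutual distances; `λ = 16^{-(N²+1)}`), instantiate (WL), (ID), (EXC) at `ρ` and
clearance `1/8`, take the kinematic time of part 2 and the error envelope `Z` of `ζ⁺` (part 5), and run the
staircase of parts 6–7: `|kin S t₂ − kin S t₁| ≤ 2N·Z(t₁) + B·∫ (min (r s) s)^{-3/2}` componentwise; the momentum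
vector costs a factor `3`. Hence `ζ₀ := 6N·Z`, `C₀ := 3B`. Mathlib only. [folklore]
-/

noncomputable section

set_option linter.dupNamespace false

open scoped BigOperators Classical Topology
open Finset Filter MeasureTheory intervalIntegral

namespace Summit.FinalStateConjecture.FinalStateConjecture.Theorems.SublinearIsFree.Staircase

open Literature.Geometry.Lorentzian


/-! ### Two small packaging lemmas -/

/-- The Euclidean norm on `E3` is at most the sum of the absolute values of the coordinates. [folklore] -/
private theorem norm_le_sum_abs' (x : E3) : ‖x‖ ≤ ∑ i, |x i| := by
  rw [EuclideanSpace.norm_eq]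
  have h0 : ∀ i, 0 ≤ |x i| := fun i ↦ abs_nonneg _
  have hsq : ∑ i, ‖x i‖ ^ 2 ≤ (∑ i, |x i|) ^ 2 := by
    simp only [Real.norm_eq_abs]
    calc ∑ i, |x i| ^ 2 ≤ ∑ i, |x i| * ∑ j, |x j| := by
          refine Finset.sum_le_sum fun i _ ↦ ?_
          rw [sq]
          exact mul_le_mul_of_nonneg_left (Finset.single_le_sum (fun j _ ↦ h0 j) (Finset.mem_univ i)) (h0 i)
      _ = (∑ i, |x i|) ^ 2 := by rw [← Finset.sum_mul, sq]
  calc √(∑ i, ‖x i‖ ^ 2) ≤ √((∑ i, |x i|) ^ 2) := Real.sqrt_le_sqrt hsq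
    _ = ∑ i, |x i| := Real.sqrt_sq (Finset.sum_nonneg fun i _ ↦ h0 i)

/-- The momentum VECTOR of a member set from its three components: componentwise bounds `≤ b` give `≤ 3b`.
[folklore] -/
private theorem norm_momentum_sub_le {N : ℕ} (A : Finset (Fin N)) (M : Fin N → ℝ) (w₁ w₂ : Fin N → E3) {b : ℝ}
    (h : ∀ k : Fin 3, |∑ j ∈ A, M j * (√(1 - ‖w₂ j‖ ^ 2))⁻¹ * w₂ j k - ∑ j ∈ A, M j * (√(1 - ‖w₁ j‖ ^ 2))⁻¹ * w₁ j k| ≤ b) :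
    ‖∑ j ∈ A, (M j * (√(1 - ‖w₂ j‖ ^ 2))⁻¹) • w₂ j - ∑ j ∈ A, (M j * (√(1 - ‖w₁ j‖ ^ 2))⁻¹) • w₁ j‖ ≤ 3 * b := by
  calc ‖∑ j ∈ A, (M j * (√(1 - ‖w₂ j‖ ^ 2))⁻¹) • w₂ j - ∑ j ∈ A, (M j * (√(1 - ‖w₁ j‖ ^ 2))⁻¹) • w₁ j‖
      ≤ ∑ k, |(∑ j ∈ A, (M j * (√(1 - ‖w₂ j‖ ^ 2))⁻¹) • w₂ j - ∑ j ∈ A, (M j * (√(1 - ‖w₁ j‖ ^ 2))⁻¹) • w₁ j) k| :=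
        norm_le_sum_abs' _
    _ ≤ ∑ _k : Fin 3, b := by
        refine Finset.sum_le_sum fun k _ ↦ ?_
        have heq : (∑ j ∈ A, (M j * (√(1 - ‖w₂ j‖ ^ 2))⁻¹) • w₂ j - ∑ j ∈ A, (M j * (√(1 - ‖w₁ j‖ ^ 2))⁻¹) • w₁ j) k =
            ∑ j ∈ A, M j * (√(1 - ‖w₂ j‖ ^ 2))⁻¹ * w₂ j k - ∑ j ∈ A, M j * (√(1 - ‖w₁ j‖ ^ 2))⁻¹ * w₁ j k := by
          simp only [PiLp.sub_apply, WithLp.ofLp_sum, Finset.sum_apply, PiLp.smul_apply, smul_eq_mul]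
        rw [heq]
        exact h k
    _ = 3 * b := by simp

/-! ### The registered stub -/

/-- **INTEGRATED CLUSTER BALANCE from WINDOW LAW + IDENTIFICATION + CLEAN EXCISION** (registered stub
`stub_integratedClusterBalance` of the crux skeleton, line `SketchCleanExcision`; see the module docstring for
statement and proof). [folklore] -/
theorem stub_integratedClusterBalance :
    ∀ (N : ℕ) (M : Fin N → ℝ) (ξ v : Fin N → ℝ → E3) (κ : ℝ) (P : ℝ → E3 → ℝ → Fin 4 → ℝ), (∀ i, 0 < M i) → 0 < κ → κ < 1 → (∀ i, ContDiff ℝ ((⊤ : ℕ∞) : WithTop ℕ∞) (ξ i)) → (∀ i, ∀ᶠ t in atTop, ‖ξ i t‖ ≤ κ ^ 2 * t) → (∀ i j, i ≠ j → Tendsto (fun t ↦ ‖ξ i t - ξ j t‖) atTop atTop) → (∀ i, Continuous (v i)) → (∃ k : ℝ, 0 ≤ k ∧ k < 1 ∧ ∀ i t, ‖v i t‖ ≤ k) → (∀ i, Tendsto (fun t ↦ deriv (ξ i) t - v i t) atTop (𝓝 0)) → (∀ ρ : ℝ → ℝ, Tendsto ρ atTop atTop → ∀ δ : ℝ, 0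 < δ → δ < 1 → ∃ (C T : ℝ), ∀ (t₁ t₂ : ℝ) (c : ℝ → E3) (R : ℝ → ℝ), T ≤ t₁ → t₁ ≤ t₂ → (∀ s ∈ Set.Icc t₁ t₂, ∀ s' ∈ Set.Icc t₁ t₂, ‖c s - c s'‖ ≤ 2 * |s - s'| ∧ |R s - R s'| ≤ 2 * |s - s'|) → (∀ s ∈ Set.Icc t₁ t₂, ρ s ≤ δ * R s ∧ ‖c s‖ + R s ≤ (κ + κ ^ 2) / 2 * s ∧ ∀ j, ‖ξ j s - c s‖ ≤ (1 - δ) * R s ∨ (1 + δ) * R s ≤ ‖ξ j s - c s‖) → ∀ μ : Fin 4, |P t₂ (c t₂) (R t₂) μ - P t₁ (c t₁) (R t₁) μ| ≤ C * ∫ s in t₁..t₂, (R s ^ (3 / 2 : ℝ))⁻¹) → (∀ ρ : ℝ → ℝ, Tendsto ρ atTop atTop → ∀ δ : ℝ, 0 < δ → δ < 1 → ∃ (T : ℝ) (ζ : ℝ → ℝ), Tendsto ζ atTop (𝓝 0) ∧ ∀ (t : ℝ) (c : E3) (R : ℝ) (A : Finset (Fin N)), T ≤ t → ρ t ≤ δ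 * R → ‖c‖ + R ≤ (κ + κ ^ 2) / 2 * t → (∀ j, ‖ξ j t - c‖ ≤ (1 - δ) * R ∨ (1 + δ) * R ≤ ‖ξ j t - c‖) → (∀ j, j ∈ A ↔ ‖ξ j t - c‖ ≤ (1 - δ) * R) → |P t c R 0 - ∑ j ∈ A, M j * (√(1 - ‖v j t‖ ^ 2))⁻¹| ≤ ζ t ∧ ∀ k : Fin 3, |P t c R k.succ - ∑ j ∈ A, M j * (√(1 - ‖v j t‖ ^ 2))⁻¹ * v j t k| ≤ ζ t) → (∀ ρ : ℝ → ℝ, Tendsto ρ atTop atTop → ∀ δ : ℝ, 0 < δ → δ < 1 → ∃ (C T : ℝ), ∀ (t : ℝ) (c : E3) (R Rm : ℝ) (m : ℕ) (c' : Fin m → E3) (R' : Fin m → ℝ), T ≤ t → 0 < Rm → ρ t ≤ δ * Rm → Rm ≤ R → (∀ k, Rm ≤ R' k) → ‖c‖ + R ≤ (κ + κ ^ 2) / 2 * t → (∀ j, ‖ξ j t - c‖ ≤ (1 - δ) * R ∨ (1 + δ) * R ≤ ‖ξ j t - c‖) → (∀ k j, ‖ξ j t - c' k‖ ≤ (1 -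 δ) * R' k ∨ (1 + δ) * R' k ≤ ‖ξ j t - c' k‖) → (∀ k, ‖c' k - c‖ + (1 + δ) * R' k ≤ (1 - δ) * R) → (∀ k l, k ≠ l → (1 + δ) * (R' k + R' l) ≤ ‖c' k - c' l‖) → (∀ j, ‖ξ j t - c‖ ≤ (1 - δ) * R → ∃ k, ‖ξ j t - c' k‖ ≤ (1 - δ) * R' k) → ∀ μ : Fin 4, |P t c R μ - ∑ k, P t (c' k) (R' k) μ| ≤ C * (√Rm)⁻¹) → ∃ (C₀ T₀ : ℝ) (ζ₀ : ℝ → ℝ), Tendsto ζ₀ atTop (𝓝 0) ∧ ∀ (S : Finset (Fin N)) (t₁ t₂ : ℝ) (r : ℝ → ℝ), T₀ ≤ t₁ → t₁ ≤ t₂ → S.Nonempty → ContinuousOn r (Set.Icc t₁ t₂) → (∀ s ∈ Set.Icc t₁ t₂, 0 < r s ∧ ∀ i ∈ S, ∀ j ∉ S, r s ≤ ‖ξ i s - ξ j s‖) → ‖∑ j ∈ S, (M j * (√(1 - ‖v j t₂‖ ^ 2))⁻¹) • v j t₂ - ∑ j ∈ S, (M j * (√(1 - ‖v j t₁‖ ^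 2))⁻¹) • v j t₁‖ ≤ ζ₀ t₁ + C₀ * ∫ s in t₁..t₂, ((min (r s) s) ^ (3 / 2 : ℝ))⁻¹ ∧ |∑ j ∈ S, M j * (√(1 - ‖v j t₂‖ ^ 2))⁻¹ - ∑ j ∈ S, M j * (√(1 - ‖v j t₁‖ ^ 2))⁻¹| ≤ ζ₀ t₁ + C₀ * ∫ s in t₁..t₂, ((min (r s) s) ^ (3 / 2 : ℝ))⁻¹ := by
  intro N M ξ v κ P _hM hκ hκ1 hsm hcone hsep _hcont hk hmis hWLa hIDa hEa
  -- constants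
  set c₀ : ℝ := (κ - κ ^ 2) / 2 with hc₀
  set lam : ℝ := ((16 : ℝ) ^ (N ^ 2 + 1))⁻¹ with hlam
  set cρ : ℝ := lam ^ 2 / 8 with hcρ
  set ρ : ℝ → ℝ := fun s ↦ cρ * (Finset.fold min (c₀ * s) (fun pp ↦ ‖ξ (Prod.fst pp) s - ξ (Prod.snd pp) s‖) (Finset.offDiag Finset.univ)) with hρdef
  have hc := c₀_pos_le hκ hκ1 hc₀
  obtain ⟨hl0, hl1⟩ := lam_pos_le (N := N) hlam
  have hcρpos : 0 < cρ := by rw [hcρ]; positivity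
  have hρ : Tendsto ρ atTop atTop := (tendsto_gsc (ξ := ξ) hc.1 hsep).const_mul_atTop hcρpos
  -- instantiate the three charge hypotheses at `ρ`, clearance `1/8`
  obtain ⟨C_W, T_W, hWL⟩ := hWLa ρ hρ (1 / 8) (by norm_num) (by norm_num)
  obtain ⟨T_I, ζ, hζ, hID⟩ := hIDa ρ hρ (1 / 8) (by norm_num) (by norm_num)
  obtain ⟨C_E', T_E, hE'⟩ := hEa ρ hρ (1 / 8) (by norm_num) (by norm_num)
  -- kinematics and the error envelope
  obtain ⟨T_K, hTK1, hconeK, -, hsep1, hlip⟩ := exists_kinematicTime ξ v κ hsm hcone hsep hk hmis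
  obtain ⟨T_Z, Z, hZ0, hZnn, hZ⟩ := exists_envelope hζ
  -- the common late time
  set T : ℝ := max (max (max T_K T_W) (max T_I T_E)) T_Z with hTdef
  have hTK : T_K ≤ T := by rw [hTdef]; simp
  have hTW : T_W ≤ T := by rw [hTdef]; simp
  have hTI : T_I ≤ T := by rw [hTdef]; simp
  have hTE : T_E ≤ T := by rw [hTdef]; simp
  have hTZ : T_Z ≤ T := by rw [hTdef]; simp
  have hT1 : 1 ≤ T := hTK1.trans hTK
  -- the constants of the bound
  set C_E : ℝ := max C_E' 0 with hCE
  set A : ℝ := 2 / (lam * c₀) with hA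
  set B : ℝ := N * max C_W 0 * (A * √A) + 2 * (N * C_E * (2 * A * √A / lam)) with hB
  have hCE0 : 0 ≤ C_E := le_max_right _ _
  obtain ⟨hB0, -⟩ := B_bounds (C_W := C_W) hκ hκ1 hc₀ hlam hA hB hCE0
  refine ⟨3 * B, T, fun t ↦ 6 * N * Z t, ?_, ?_⟩
  · -- `ζ₀ → 0`
    simpa using hZ0.const_mul (6 * (N : ℝ))
  intro S t₁ t₂ r ht₁ h12 _hS hrcont hr
  -- the instantiated hypotheses in the form of part 6
  have hWL' : ∀ (t₁ t₂ : ℝ) (c : ℝ → E3) (R : ℝ → ℝ), T ≤ t₁ → t₁ ≤ t₂ →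
      (∀ s ∈ Set.Icc t₁ t₂, ∀ s' ∈ Set.Icc t₁ t₂, ‖c s - c s'‖ ≤ 2 * |s - s'| ∧ |R s - R s'| ≤ 2 * |s - s'|) →
      (∀ s ∈ Set.Icc t₁ t₂, ρ s ≤ 1 / 8 * R s ∧ ‖c s‖ + R s ≤ (κ + κ ^ 2) / 2 * s ∧
        ∀ j, ‖ξ j s - c s‖ ≤ (1 - 1 / 8) * R s ∨ (1 + 1 / 8) * R s ≤ ‖ξ j s - c s‖) →
      ∀ μ : Fin 4, |P t₂ (c t₂) (R t₂) μ - P t₁ (c t₁) (R t₁) μ| ≤ C_W * ∫ s in t₁..t₂, (R s ^ (3 / 2 : ℝ))⁻¹ :=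
    fun t₁ t₂ c R hT ↦ hWL t₁ t₂ c R (hTW.trans hT)
  have hID' : ∀ (t : ℝ) (c : E3) (R : ℝ) (A : Finset (Fin N)), T ≤ t → ρ t ≤ 1 / 8 * R →
      ‖c‖ + R ≤ (κ + κ ^ 2) / 2 * t →
      (∀ j, ‖ξ j t - c‖ ≤ (1 - 1 / 8) * R ∨ (1 + 1 / 8) * R ≤ ‖ξ j t - c‖) →
      (∀ j, j ∈ A ↔ ‖ξ j t - c‖ ≤ (1 - 1 / 8) * R) →
      |P t c R 0 - ∑ j ∈ A, M j * (√(1 - ‖v j t‖ ^ 2))⁻¹| ≤ max (ζ t) 0 ∧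
      ∀ k : Fin 3, |P t c R k.succ - ∑ j ∈ A, M j * (√(1 - ‖v j t‖ ^ 2))⁻¹ * v j t k| ≤ max (ζ t) 0 := by
    intro t c R A hT h1 h2 h3 h4
    have h := hID t c R A (hTI.trans hT) h1 h2 h3 h4
    exact ⟨h.1.trans (le_max_left _ _), fun k ↦ (h.2 k).trans (le_max_left _ _)⟩
  have hE' : ∀ (t : ℝ) (c : E3) (R Rm : ℝ) (I : Finset (Fin N)) (c' : Fin N → E3) (R' : Fin N → ℝ), T ≤ t → 0 < Rm →
      ρ t ≤ 1 / 8 * Rm → Rm ≤ R → (∀ k ∈ I, Rm ≤ R' k) → ‖c‖ + R ≤ (κ + κ ^ 2) / 2 * t →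
      (∀ j, ‖ξ j t - c‖ ≤ (1 - 1 / 8) * R ∨ (1 + 1 / 8) * R ≤ ‖ξ j t - c‖) →
      (∀ k ∈ I, ∀ j, ‖ξ j t - c' k‖ ≤ (1 - 1 / 8) * R' k ∨ (1 + 1 / 8) * R' k ≤ ‖ξ j t - c' k‖) →
      (∀ k ∈ I, ‖c' k - c‖ + (1 + 1 / 8) * R' k ≤ (1 - 1 / 8) * R) →
      (∀ k ∈ I, ∀ l ∈ I, k ≠ l → (1 + 1 / 8) * (R' k + R' l) ≤ ‖c' k - c' l‖) →
      (∀ j, ‖ξ j t - c‖ ≤ (1 - 1 / 8) * R → ∃ k ∈ I, ‖ξ j t - c' k‖ ≤ (1 - 1 / 8) * R' k) →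
      ∀ μ : Fin 4, |P t c R μ - ∑ k ∈ I, P t (c' k) (R' k) μ| ≤ C_E * (√Rm)⁻¹ := by
    intro t c R Rm I c' R' hT hRm h1 h2 h3 h4 h5 h6 h7 h8 h9 μ
    have h := excision_finset (fun m c'' R'' g1 g2 g3 g4 g5 ↦
      hE' t c R Rm m c'' R'' (hTE.trans hT) hRm h1 h2 g1 h4 h5 g2 g3 g4 g5) I c' R' h3 h6 h7 h8 h9 μ
    exact h.trans (mul_le_mul_of_nonneg_right (le_max_left _ _) (by positivity))
  -- integrability of the flux integrand on sub-intervals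
  have hfcont : ContinuousOn (fun s ↦ ((min (r s) s) ^ (3 / 2 : ℝ))⁻¹) (Set.Icc t₁ t₂) := by
    have hmin : ContinuousOn (fun s ↦ min (r s) s) (Set.Icc t₁ t₂) :=
      continuous_min.comp_continuousOn (hrcont.prodMk continuousOn_id)
    have hpos : ∀ s ∈ Set.Icc t₁ t₂, 0 < min (r s) s := fun s hs ↦
      lt_min (hr s hs).1 (by linarith [hs.1, hT1, ht₁])
    refine (hmin.rpow_const fun s hs ↦ Or.inr (by norm_num)).inv₀ fun s hs ↦ ?_
    exact (Real.rpow_pos_of_pos (hpos s hs) _).ne'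
  have hfi : ∀ a b, t₁ ≤ a → a ≤ b → b ≤ t₂ →
      IntervalIntegrable (fun s ↦ ((min (r s) s) ^ (3 / 2 : ℝ))⁻¹) volume a b := fun a b ha hab hb ↦
    (hfcont.mono (Set.Icc_subset_Icc ha hb)).intervalIntegrable_of_Icc hab
  -- THE STAIRCASE (parts 6–7)
  have key := staircase_bound (M := M) (v := v) (P := P) (S := S) hκ hκ1 hT1 (fun i s hs ↦ hconeK i s (hTK.trans hs))
    (fun i j s hij hs ↦ hsep1 i j s hij (hTK.trans hs)) (fun i s s' hs hs' ↦ hlip i s s' (hTK.trans hs) (hTK.trans hs'))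
    hc₀ hlam hcρ (fun s ↦ rfl) hA hB hCE0 hWL' hID' (fun t ↦ le_max_right _ _)
    (fun t s ht hts ↦ hZ t s (hTZ.trans ht) hts) hE' ht₁ h12 hr hfi
  -- packaging
  have hInn : 0 ≤ ∫ s in t₁..t₂, ((min (r s) s) ^ (3 / 2 : ℝ))⁻¹ :=
    intervalIntegral.integral_nonneg h12 fun s hs ↦ by
      have : 0 < min (r s) s := lt_min (hr s hs).1 (by linarith [hs.1, hT1, ht₁])
      positivity
  have hmono : 2 * N * Z t₁ + B * ∫ s in t₁..t₂, ((min (r s) s) ^ (3 / 2 : ℝ))⁻¹ ≤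
      6 * N * Z t₁ + 3 * B * ∫ s in t₁..t₂, ((min (r s) s) ^ (3 / 2 : ℝ))⁻¹ := by
    have := hZnn t₁
    nlinarith
  constructor
  · -- momentum vector
    have hcomp : ∀ k : Fin 3, |∑ j ∈ S, M j * (√(1 - ‖v j t₂‖ ^ 2))⁻¹ * v j t₂ k -
        ∑ j ∈ S, M j * (√(1 - ‖v j t₁‖ ^ 2))⁻¹ * v j t₁ k| ≤
        2 * N * Z t₁ + B * ∫ s in t₁..t₂, ((min (r s) s) ^ (3 / 2 : ℝ))⁻¹ := fun k ↦ by
      simpa only [Fin.cons_succ] using key k.succ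
    calc _ ≤ 3 * (2 * N * Z t₁ + B * ∫ s in t₁..t₂, ((min (r s) s) ^ (3 / 2 : ℝ))⁻¹) :=
          norm_momentum_sub_le S M (fun j ↦ v j t₁) (fun j ↦ v j t₂) hcomp
      _ = 6 * N * Z t₁ + 3 * B * ∫ s in t₁..t₂, ((min (r s) s) ^ (3 / 2 : ℝ))⁻¹ := by ring
  · -- energy
    have h0 := key 0
    simp only [Fin.cons_zero] at h0
    exact h0.trans hmono
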